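import Literature.NumberTheory.DiophantineApproximation.DilogHermitePadeSeries
import Mathlib.Analysis.SpecialFunctions.Log.Basic
import Mathlib.Analysis.Normed.Group.InfiniteSum
import Mathlib.Analysis.SpecificLimits.Basic
import Mathlib.Algebra.Polynomial.Roots
import HarnessLib

/-!
# Functional independence of `1, Li₂(1/z), log z, log z·Li₁(1/z)` over `ℝ[z]`

Topic `Literature/NumberTheory/DiophantineApproximation`. PROVED theorems only; no definitions of
notions, no named facts.

**Main result** (`eq_zero_of_polylog_log_combination`). If `A, B, C, E ∈ ℝ[z]` and
`A(z) + B(z) Li₂(1/z) + log z · (C(z) + E(z) Li₁(1/z)) = 0` for all real `z ≥ 2`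
(`Li_s(x) = Σ_{k≥1} x^k/k^s = DilogPade.polylogSeries s x`), then `A = B = C = E = 0`.

Consequence used for Viola–Zudilin [ViolaZudilin2018, §3] / Rhin–Viola [RhinViola2005, §3]: in an
identity `N(z)·J_z = P(z) − Q(z) Li₂(1/z)`, `N(z)·J_z^{(1)} = R(z) − Q(z) Li₁(1/z)` coming from
`J_z = J_z^{(0)} − log z · J_z^{(1)}`, i.e. `N(z) J_z^{(0)} = P − Q Li₂ + log z (R − Q Li₁)`, the
polynomials `P, Q, R` are determined by the real-analytic function `z ↦ J_z^{(0)}` alone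
(`polylog_log_representation_unique`); hence every identity between the real integrals `J_z^{(0)}`
of two parameter tuples (the permutations `ν`, `ϕ` of VZ Lemmas 3.1–3.2, RV (3.5)) transfers to
`P, Q, R` and thereby to `J_z^{(1)}`, `J_z^{(2)}` without interchanging contour integrals.

Proof. (1) A generic asymptotic lemma (`coeff_eq_zero_of_hasSum_log`): if `F(z) = Σ_n u_n z^{−n}`,
`G(z) = Σ_n v_n z^{−n}` with bounded coefficients and `F + G log z = 0` on `[2,∞)`, then all
`u_n = v_n = 0` — by induction on `n`: after the first `n` coefficients vanish,
`u_n + v_n log z = O(1/z) + O(log z/z) → 0`, forcing `v_n = 0` (else `|v_n| log z → ∞`) and then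
`u_n = 0`. (2) `z^{−d}(A(z) + B(z)Li₂(1/z))` is such a series with
`u_n = a_{d−n} + Σ_t b_t/(n+t−d)²` (terms with `n+t > d`), so for `s ≥ 1`: `Σ_t b_t/(s+t)² = 0`,
whence `b = 0` (`eq_zero_of_sum_div_pow_eq_zero`: the polynomial `Σ_t b_t Π_{t'≠t}(X+t')²` of degree
`≤ 2d` has the `2d+1` roots `1,…,2d+1`, and its value at `−t` is `b_t Π_{t'≠t}(t'−t)²`), then `a = 0`;
likewise `E = C = 0` with first powers.

## References

* C. Viola, W. Zudilin, J. reine angew. Math. 736 (2018) 193–223, §3 (Lemmas 3.1–3.3, Prop. 3.1).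
  [ViolaZudilin2018]
* G. Rhin, C. Viola, Ann. Sc. Norm. Super. Pisa Cl. Sci. (5) 4 (2005) 389–437, §3, (3.5)–(3.7).
  [RhinViola2005]
-/

noncomputable section

namespace Literature.NumberTheory.DiophantineApproximation

namespace DilogPade

open Finset Polynomial Filter Topology

/-! ### The generic asymptotic lemma -/

/-- Tail bound: `|Σ_m w_m x^m| ≤ 2M` for `|w_m| ≤ M`, `0 ≤ x ≤ 1/2`. [folklore] -/
theorem norm_tsum_le_of_abs_le {w : ℕ → ℝ} {M x : ℝ} (hw : ∀ m, |w m| ≤ M) (hx0 : 0 ≤ x) (hx : x ≤ 1 / 2) :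
    |∑' m, w m * x ^ m| ≤ 2 * M := by
  have hM : 0 ≤ M := (abs_nonneg _).trans (hw 0)
  have hg : HasSum (fun m : ℕ => M * (1 / 2 : ℝ) ^ m) (2 * M) := by
    have h := (hasSum_geometric_of_lt_one (by norm_num : (0 : ℝ) ≤ 1 / 2) (by norm_num)).mul_left M
    rwa [show M * (1 - 1 / 2 : ℝ)⁻¹ = 2 * M by ring] at h
  have key : ‖∑' m, w m * x ^ m‖ ≤ 2 * M := by
    refine tsum_of_norm_bounded hg fun m => ?_
    rw [Real.norm_eq_abs, abs_mul, abs_pow, abs_of_nonneg hx0]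
    exact mul_le_mul (hw m) (pow_le_pow_left₀ hx0 hx m) (pow_nonneg hx0 _) hM
  rwa [Real.norm_eq_abs] at key

/-- Summability of `m ↦ w_{m+k} x^m` for bounded `w` and `0 ≤ x ≤ 1/2`. [folklore] -/
theorem summable_shift_mul_pow {w : ℕ → ℝ} {M x : ℝ} (hw : ∀ m, |w m| ≤ M) (hx0 : 0 ≤ x) (hx : x ≤ 1 / 2)
    (k : ℕ) : Summable fun m : ℕ => w (m + k) * x ^ m := by
  refine Summable.of_norm_bounded ((summable_geometric_of_lt_one (by norm_num : (0 : ℝ) ≤ 1 / 2)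
    (by norm_num)).mul_left M) fun m => ?_
  rw [Real.norm_eq_abs, abs_mul, abs_pow, abs_of_nonneg hx0]
  exact mul_le_mul (hw _) (pow_le_pow_left₀ hx0 hx m) (pow_nonneg hx0 _) ((abs_nonneg _).trans (hw 0))

/-- Peeling the first `n` (vanishing) coefficients: `F(x) = x^n (u_n + x·T)` with `|T| ≤ 2M`.
[folklore] -/
theorem hasSum_peel {u : ℕ → ℝ} {M x F : ℝ} (hu : ∀ m, |u m| ≤ M) (hx0 : 0 ≤ x) (hx : x ≤ 1 / 2)
    (hF : HasSum (fun m => u m * x ^ m) F) {n : ℕ} (hn : ∀ m < n, u m = 0) :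
    ∃ T : ℝ, |T| ≤ 2 * M ∧ F = x ^ n * (u n + x * T) := by
  refine ⟨∑' m, u (m + (n + 1)) * x ^ m, norm_tsum_le_of_abs_le (fun m => hu _) hx0 hx, ?_⟩
  have h1 : HasSum (fun m => u (m + n) * x ^ (m + n)) F := by
    rw [← sub_zero F, ← show ∑ i ∈ range n, u i * x ^ i = 0 from
      sum_eq_zero fun i hi => by rw [hn i (mem_range.1 hi), zero_mul]]
    exact (hasSum_nat_add_iff' n).2 hF
  have hs := summable_shift_mul_pow hu hx0 hx n
  have h2 : HasSum (fun m => u (m + n) * x ^ (m + n)) (x ^ n * ∑' m, u (m + n) * x ^ m) := by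
    have := hs.hasSum.mul_left (x ^ n)
    refine this.congr_fun fun m => ?_
    simp only [pow_add]; ring
  rw [h1.unique h2, hs.tsum_eq_zero_add]
  simp only [zero_add, pow_zero, mul_one]
  congr 1
  rw [← tsum_mul_left]
  congr 1
  refine tsum_congr fun m => ?_
  rw [show m + 1 + n = m + (n + 1) by omega, pow_succ]
  ring

/-- **The asymptotic lemma**: if `Σ_n u_n z^{−n} + log z · Σ_n v_n z^{−n} = 0` for all `z ≥ 2`
(bounded coefficients), then all `u_n` and `v_n` vanish. [folklore] -/
theorem coeff_eq_zero_of_hasSum_log {u v : ℕ → ℝ} {M : ℝ} (hu : ∀ n, |u n| ≤ M) (hv : ∀ n, |v n| ≤ M)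
    {F G : ℝ → ℝ} (hF : ∀ z : ℝ, 2 ≤ z → HasSum (fun n => u n * z⁻¹ ^ n) (F z))
    (hG : ∀ z : ℝ, 2 ≤ z → HasSum (fun n => v n * z⁻¹ ^ n) (G z))
    (h : ∀ z : ℝ, 2 ≤ z → F z + Real.log z * G z = 0) : ∀ n, u n = 0 ∧ v n = 0 := by
  have hM : 0 ≤ M := (abs_nonneg _).trans (hu 0)
  intro n
  induction n using Nat.strong_induction_on with
  | _ n IH =>
  -- the relation `u_n + v_n log z = ρ(z)` with `|ρ(z)| ≤ 2M/z + 2M log z/z`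
  have hrel : ∀ z : ℝ, 2 ≤ z → |u n + Real.log z * v n| ≤ 2 * M * z⁻¹ + 2 * M * (Real.log z / z) := by
    intro z hz
    have hz0 : 0 < z := by linarith
    have hx0 : 0 ≤ z⁻¹ := by positivity
    have hx : z⁻¹ ≤ 1 / 2 := by rw [one_div]; exact inv_anti₀ (by norm_num) hz
    obtain ⟨Tu, hTu, hFu⟩ := hasSum_peel hu hx0 hx (hF z hz) fun m hm => (IH m hm).1
    obtain ⟨Tv, hTv, hGv⟩ := hasSum_peel hv hx0 hx (hG z hz) fun m hm => (IH m hm).2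
    have h0 := h z hz
    rw [hFu, hGv] at h0
    have hxn : (z⁻¹) ^ n ≠ 0 := pow_ne_zero _ (inv_ne_zero hz0.ne')
    have h1 : u n + Real.log z * v n = -(z⁻¹ * Tu + Real.log z * (z⁻¹ * Tv)) := by
      have : (z⁻¹) ^ n * (u n + z⁻¹ * Tu + Real.log z * (v n + z⁻¹ * Tv)) = 0 := by
        rw [← h0]; ring
      have := (mul_eq_zero.1 this).resolve_left hxn
      linarith
    have hlog : 0 ≤ Real.log z := Real.log_nonneg (by linarith)
    rw [h1, abs_neg]
    calc |z⁻¹ * Tu + Real.log z * (z⁻¹ * Tv)| ≤ |z⁻¹ * Tu| + |Real.log z * (z⁻¹ * Tv)| := abs_add_le _ _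
      _ = z⁻¹ * |Tu| + Real.log z / z * |Tv| := by
          rw [abs_mul, abs_mul, abs_mul, abs_of_nonneg hx0, abs_of_nonneg hlog, div_eq_mul_inv]; ring
      _ ≤ z⁻¹ * (2 * M) + Real.log z / z * (2 * M) := by gcongr
      _ = _ := by ring
  -- hence `u_n + v_n log z → 0`
  have hlim : Tendsto (fun z => u n + Real.log z * v n) atTop (𝓝 0) := by
    refine squeeze_zero_norm' (a := fun z => 2 * M * z⁻¹ + 2 * M * (Real.log z / z)) ?_ ?_
    · filter_upwards [eventually_ge_atTop (2 : ℝ)] with z hz using hrel z hz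
    · have h1 : Tendsto (fun z : ℝ => 2 * M * z⁻¹) atTop (𝓝 0) := by
        simpa using tendsto_inv_atTop_zero.const_mul (2 * M)
      have h2 : Tendsto (fun z : ℝ => 2 * M * (Real.log z / z)) atTop (𝓝 0) := by
        have := (Real.tendsto_pow_log_div_mul_add_atTop 1 0 1 one_ne_zero).const_mul (2 * M)
        simpa using this
      simpa using h1.add h2
  have hvn : v n = 0 := by
    by_contra hv0
    have : Tendsto (fun z => Real.log z) atTop (𝓝 ((0 - u n) / v n)) := by
      have := (hlim.sub_const (u n)).div_const (v n)
      refine this.congr' ?_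
      filter_upwards with z
      field_simp
      ring
    exact not_tendsto_nhds_of_tendsto_atTop Real.tendsto_log_atTop _ this
  refine ⟨?_, hvn⟩
  have : Tendsto (fun _ : ℝ => u n) atTop (𝓝 0) := by simpa [hvn] using hlim
  exact tendsto_nhds_unique tendsto_const_nhds this

/-! ### Coefficient extraction -/

/-- If `Σ_{t ≤ d} e_t/(s+t)^κ = 0` for all integers `s = 1, …, κ d + 1` (`κ ≥ 1`), then `e = 0` on
`{0,…,d}` (partial fractions with distinct poles). [folklore] -/
theorem eq_zero_of_sum_div_pow_eq_zero {d κ : ℕ} (hκ : 1 ≤ κ) {e : ℕ → ℝ}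
    (he : ∀ s : ℕ, 1 ≤ s → s ≤ κ * d + 1 → ∑ t ∈ range (d + 1), e t / ((s : ℝ) + t) ^ κ = 0) :
    ∀ t ∈ range (d + 1), e t = 0 := by
  classical
  -- the polynomial `Σ_t e_t Π_{t' ≠ t} (X + t')^κ`
  set P : ℝ[X] := ∑ t ∈ range (d + 1), Polynomial.C (e t) *
    ∏ t' ∈ (range (d + 1)).erase t, (X + Polynomial.C (t' : ℝ)) ^ κ with hP
  have hdeg : P.natDegree ≤ κ * d := by
    refine natDegree_sum_le_of_forall_le _ _ fun t ht => ?_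
    refine (natDegree_C_mul_le _ _).trans ((natDegree_prod_le _ _).trans ?_)
    calc ∑ t' ∈ (range (d + 1)).erase t, ((X + Polynomial.C (t' : ℝ)) ^ κ).natDegree
        ≤ ∑ t' ∈ (range (d + 1)).erase t, κ := by
          refine sum_le_sum fun t' _ => ?_
          exact natDegree_pow_le.trans (by rw [natDegree_X_add_C, mul_one])
      _ = κ * d := by rw [sum_const, card_erase_of_mem ht, card_range, smul_eq_mul, Nat.add_sub_cancel, mul_comm]
  -- it vanishes at `s = 1, …, κ d + 1`
  have heval : ∀ s : ℕ, 1 ≤ s → s ≤ κ * d + 1 → P.eval (s : ℝ) = 0 := by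
    intro s hs1 hs2
    have hne : ∀ t : ℕ, ((s : ℝ) + t) ^ κ ≠ 0 := fun t => pow_ne_zero _ (by positivity)
    have hprod : ∀ t ∈ range (d + 1), (∏ t' ∈ (range (d + 1)).erase t, ((s : ℝ) + t') ^ κ) =
        (∏ t' ∈ range (d + 1), ((s : ℝ) + t') ^ κ) / ((s : ℝ) + t) ^ κ := by
      intro t ht
      rw [eq_div_iff (hne t), prod_erase_mul _ _ ht]
    rw [hP, eval_finsetSum]
    simp only [eval_mul, eval_C, eval_prod, eval_pow, eval_add, eval_X]
    calc ∑ t ∈ range (d + 1), e t * ∏ t' ∈ (range (d + 1)).erase t, ((s : ℝ) + t') ^ κ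
        = (∏ t' ∈ range (d + 1), ((s : ℝ) + t') ^ κ) * ∑ t ∈ range (d + 1), e t / ((s : ℝ) + t) ^ κ := by
          rw [mul_sum]
          refine sum_congr rfl fun t ht => ?_
          rw [hprod t ht]
          ring
      _ = 0 := by rw [he s hs1 hs2, mul_zero]
  -- hence it is zero
  have hP0 : P = 0 := by
    refine eq_zero_of_natDegree_lt_card_of_eval_eq_zero P (f := fun i : Fin (κ * d + 1) => ((i : ℕ) + 1 : ℝ))
      (fun i j hij => by
        have : (i : ℝ) = j := by simpa using hij
        exact Fin.ext (by exact_mod_cast this)) (fun i => ?_) ?_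
    · have := heval (i + 1) (by omega) (by omega)
      push_cast at this
      exact this
    · rw [Fintype.card_fin]; omega
  -- evaluate at `−t`
  intro t ht
  have h1 : P.eval (-(t : ℝ)) = e t * ∏ t' ∈ (range (d + 1)).erase t, (-(t : ℝ) + t') ^ κ := by
    rw [hP, eval_finsetSum, ← add_sum_erase _ _ ht]
    simp only [eval_mul, eval_C, eval_prod, eval_pow, eval_add, eval_X]
    rw [add_eq_left]
    refine sum_eq_zero fun t₁ ht₁ => ?_
    have ht₁t : t₁ ≠ t := (mem_erase.1 ht₁).1
    have hmem : t ∈ (range (d + 1)).erase t₁ := mem_erase.2 ⟨ht₁t.symm, ht⟩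
    rw [← mul_prod_erase _ _ hmem, neg_add_cancel, zero_pow (by omega)]
    ring
  have h2 : ∏ t' ∈ (range (d + 1)).erase t, (-(t : ℝ) + t') ^ κ ≠ 0 := by
    refine prod_ne_zero_iff.2 fun t' ht' => pow_ne_zero _ ?_
    have : t' ≠ t := (mem_erase.1 ht').1
    rw [neg_add_eq_sub, sub_ne_zero]
    exact_mod_cast this
  have h3 : P.eval (-(t : ℝ)) = 0 := by rw [hP0, eval_zero]
  rw [h1] at h3
  exact (mul_eq_zero.1 h3).resolve_right h2

/-! ### The series of `z^{−d}(A(z) + B(z) Li_κ(1/z))` -/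

/-- The coefficient sequence of `z^{−d}(A(z) + B(z) Li_κ(1/z))` in powers of `z^{−1}`
(`d ≥ deg A, deg B`). [folklore] -/
def combCoeff (κ d : ℕ) (A B : ℝ[X]) (n : ℕ) : ℝ :=
  (if n ≤ d then A.coeff (d - n) else 0) +
    ∑ t ∈ range (d + 1), if d + 1 ≤ n + t then B.coeff t / (((n + t - d : ℕ) : ℝ)) ^ κ else 0

/-- The coefficients are bounded. [folklore] -/
theorem abs_combCoeff_le (κ d : ℕ) (A B : ℝ[X]) (n : ℕ) :
    |combCoeff κ d A B n| ≤ (∑ i ∈ range (d + 1), |A.coeff i|) + ∑ t ∈ range (d + 1), |B.coeff t| := by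
  unfold combCoeff
  refine (abs_add_le _ _).trans (add_le_add ?_ ((abs_sum_le_sum_abs _ _).trans (sum_le_sum fun t _ => ?_)))
  · split_ifs with h
    · exact single_le_sum (f := fun i => |A.coeff i|) (fun i _ => abs_nonneg _) (mem_range.2 (by omega))
    · simpa using sum_nonneg fun i (_ : i ∈ range (d + 1)) => abs_nonneg (A.coeff i)
  · split_ifs with h
    · rw [abs_div, abs_pow, Nat.abs_cast]
      refine div_le_self (abs_nonneg _) (one_le_pow₀ ?_)
      exact_mod_cast (show 1 ≤ n + t - d by omega)
    · simp

/-- `x^d · A(1/x) = Σ_{n ≤ d} a_{d−n} x^n` for `deg A ≤ d`. [folklore] -/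
theorem pow_mul_eval_inv {d : ℕ} {A : ℝ[X]} (hA : A.natDegree ≤ d) {x : ℝ} (hx : x ≠ 0) :
    x ^ d * A.eval x⁻¹ = ∑ n ∈ range (d + 1), A.coeff (d - n) * x ^ n := by
  rw [eval_eq_sum_range' (by omega : A.natDegree < d + 1), mul_sum, ← sum_range_reflect]
  refine sum_congr rfl fun n hn => ?_
  have hnd : n ≤ d := Nat.lt_succ_iff.1 (mem_range.1 hn)
  have hsplit : x ^ d = x ^ n * x ^ (d - n) := by rw [← pow_add, Nat.add_sub_cancel' hnd]
  rw [show d + 1 - 1 - n = d - n by omega, inv_pow, hsplit]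
  field_simp

/-- **The expansion**: for `0 < x < 1` and `deg A, deg B ≤ d`,
`Σ_n combCoeff_n x^n = x^d (A(1/x) + B(1/x) Li_κ(x))`. [folklore] -/
theorem hasSum_combCoeff {κ d : ℕ} {A B : ℝ[X]} (hA : A.natDegree ≤ d) (hB : B.natDegree ≤ d) {x : ℝ}
    (hx0 : 0 < x) (hx1 : x < 1) :
    HasSum (fun n => combCoeff κ d A B n * x ^ n) (x ^ d * (A.eval x⁻¹ + B.eval x⁻¹ * polylogSeries κ x)) := by
  have hxne : x ≠ 0 := hx0.ne'
  have hLi : HasSum (fun m : ℕ => x ^ (m + 1) / ((m : ℝ) + 1) ^ κ) (polylogSeries κ x) :=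
    (summable_polylogSeries κ hx0.le hx1).hasSum
  -- the polynomial part
  have hApart : HasSum (fun n => (if n ≤ d then A.coeff (d - n) else 0) * x ^ n) (x ^ d * A.eval x⁻¹) := by
    have hfin : ∀ n ∉ range (d + 1), (if n ≤ d then A.coeff (d - n) else 0) * x ^ n = 0 := by
      intro n hn
      rw [mem_range, not_lt] at hn
      rw [if_neg (by omega), zero_mul]
    have h : HasSum (fun n => (if n ≤ d then A.coeff (d - n) else 0) * x ^ n)
        (∑ n ∈ range (d + 1), (if n ≤ d then A.coeff (d - n) else 0) * x ^ n) :=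
      hasSum_sum_of_ne_finset_zero hfin
    rw [pow_mul_eval_inv hA hxne]
    convert h using 1
    refine sum_congr rfl fun n hn => ?_
    rw [if_pos (Nat.lt_succ_iff.1 (mem_range.1 hn))]
  -- the `Li` part, one `t` at a time
  have hBpart : ∀ t ∈ range (d + 1), HasSum
      (fun n => (if d + 1 ≤ n + t then B.coeff t / (((n + t - d : ℕ) : ℝ)) ^ κ else 0) * x ^ n)
      (B.coeff t * x ^ (d - t) * polylogSeries κ x) := by
    intro t ht
    have htd : t ≤ d := Nat.lt_succ_iff.1 (mem_range.1 ht)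
    have hshift : HasSum (fun m : ℕ => B.coeff t / ((m : ℝ) + 1) ^ κ * x ^ (m + (d + 1 - t)))
        (B.coeff t * x ^ (d - t) * polylogSeries κ x) := by
      have := hLi.mul_left (B.coeff t * x ^ (d - t))
      refine this.congr_fun fun m => ?_
      rw [show m + (d + 1 - t) = (d - t) + (m + 1) by omega, pow_add]
      ring
    refine (hasSum_nat_add_iff' (d + 1 - t)).1 ?_
    rw [show ∑ i ∈ range (d + 1 - t), (if d + 1 ≤ i + t then B.coeff t / (((i + t - d : ℕ) : ℝ)) ^ κ else 0) * x ^ i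
      = 0 from sum_eq_zero fun i hi => by rw [if_neg (by have := mem_range.1 hi; omega), zero_mul], sub_zero]
    refine hshift.congr_fun fun m => ?_
    rw [if_pos (by omega), show m + (d + 1 - t) + t - d = m + 1 by omega]
    push_cast
    ring
  -- assemble
  have hfun : (fun n => combCoeff κ d A B n * x ^ n) = fun n =>
      (if n ≤ d then A.coeff (d - n) else 0) * x ^ n +
        ∑ t ∈ range (d + 1), (if d + 1 ≤ n + t then B.coeff t / (((n + t - d : ℕ) : ℝ)) ^ κ else 0) * x ^ n := by
    funext n
    rw [combCoeff, add_mul, sum_mul]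
  have hval : x ^ d * (A.eval x⁻¹ + B.eval x⁻¹ * polylogSeries κ x) =
      x ^ d * A.eval x⁻¹ + ∑ t ∈ range (d + 1), B.coeff t * x ^ (d - t) * polylogSeries κ x := by
    rw [mul_add, eval_eq_sum_range' (by omega : B.natDegree < d + 1), sum_mul, mul_sum]
    congr 1
    refine sum_congr rfl fun t ht => ?_
    have htd : t ≤ d := Nat.lt_succ_iff.1 (mem_range.1 ht)
    rw [inv_pow, ← div_eq_mul_inv, pow_sub₀ _ hxne htd]
    ring
  rw [hfun, hval]
  exact hApart.add (hasSum_sum hBpart)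

/-! ### The main theorem -/

/-- **Functional independence of `1, Li_κ(1/z), log z, log z·Li_{κ'}(1/z)` over `ℝ[z]`** (here for
`Li₂` and `Li₁`, the case used by Viola–Zudilin): if
`A(z) + B(z) Li₂(1/z) + log z (C(z) + E(z) Li₁(1/z)) = 0` for all `z ≥ 2`, then `A = B = C = E = 0`.
[folklore] -/
theorem eq_zero_of_polylog_log_combination {A B C E : ℝ[X]}
    (h : ∀ z : ℝ, 2 ≤ z → A.eval z + B.eval z * polylogSeries 2 (1 / z) +
      Real.log z * (C.eval z + E.eval z * polylogSeries 1 (1 / z)) = 0) :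
    A = 0 ∧ B = 0 ∧ C = 0 ∧ E = 0 := by
  set d := max (max A.natDegree B.natDegree) (max C.natDegree E.natDegree) with hd
  have hA : A.natDegree ≤ d := by omega
  have hB : B.natDegree ≤ d := by omega
  have hC : C.natDegree ≤ d := by omega
  have hE : E.natDegree ≤ d := by omega
  set M := ((∑ i ∈ range (d + 1), |A.coeff i|) + ∑ t ∈ range (d + 1), |B.coeff t|) +
    ((∑ i ∈ range (d + 1), |C.coeff i|) + ∑ t ∈ range (d + 1), |E.coeff t|) with hM
  have hM1 : ∀ n, |combCoeff 2 d A B n| ≤ M := fun n => (abs_combCoeff_le 2 d A B n).trans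
    (le_add_of_nonneg_right (by positivity))
  have hM2 : ∀ n, |combCoeff 1 d C E n| ≤ M := fun n => (abs_combCoeff_le 1 d C E n).trans
    (le_add_of_nonneg_left (by positivity))
  -- apply the asymptotic lemma to `z^{−d} × relation`
  have key := coeff_eq_zero_of_hasSum_log hM1 hM2
    (F := fun z => z⁻¹ ^ d * (A.eval z + B.eval z * polylogSeries 2 (1 / z)))
    (G := fun z => z⁻¹ ^ d * (C.eval z + E.eval z * polylogSeries 1 (1 / z)))
    (fun z hz => by
      have := hasSum_combCoeff (κ := 2) hA hB (x := z⁻¹) (by positivity) (inv_lt_one_of_one_lt₀ (by linarith))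
      simpa only [inv_inv, one_div] using this)
    (fun z hz => by
      have := hasSum_combCoeff (κ := 1) hC hE (x := z⁻¹) (by positivity) (inv_lt_one_of_one_lt₀ (by linarith))
      simpa only [inv_inv, one_div] using this)
    (fun z hz => by
      have := h z hz
      linear_combination (z⁻¹ ^ d) * this)
  -- extract: first the `Li` coefficients, for `s ≥ 1` (index `n = d + s`)
  have hBt : ∀ t ∈ range (d + 1), B.coeff t = 0 := by
    refine eq_zero_of_sum_div_pow_eq_zero (κ := 2) (by norm_num) fun s hs1 _ => ?_
    have h0 := (key (d + s)).1
    rw [combCoeff, if_neg (by omega), zero_add] at h0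
    rw [← h0]
    refine sum_congr rfl fun t ht => ?_
    rw [if_pos (by omega), show d + s + t - d = s + t by omega]
    push_cast
    ring
  have hEt : ∀ t ∈ range (d + 1), E.coeff t = 0 := by
    refine eq_zero_of_sum_div_pow_eq_zero (κ := 1) le_rfl fun s hs1 _ => ?_
    have h0 := (key (d + s)).2
    rw [combCoeff, if_neg (by omega), zero_add] at h0
    rw [← h0]
    refine sum_congr rfl fun t ht => ?_
    rw [if_pos (by omega), show d + s + t - d = s + t by omega]
    push_cast
    ring
  have hB0 : B = 0 := by
    refine Polynomial.ext fun t => ?_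
    rw [coeff_zero]
    by_cases ht : t ≤ d
    · exact hBt t (mem_range.2 (by omega))
    · exact coeff_eq_zero_of_natDegree_lt (by omega)
  have hE0 : E = 0 := by
    refine Polynomial.ext fun t => ?_
    rw [coeff_zero]
    by_cases ht : t ≤ d
    · exact hEt t (mem_range.2 (by omega))
    · exact coeff_eq_zero_of_natDegree_lt (by omega)
  -- then the polynomial coefficients (index `n ≤ d`)
  have hA0 : A = 0 := by
    refine Polynomial.ext fun i => ?_
    rw [coeff_zero]
    by_cases hi : i ≤ d
    · have h0 := (key (d - i)).1
      rw [combCoeff, if_pos (by omega), show d - (d - i) = i by omega, hB0] at h0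
      simpa using h0
    · exact coeff_eq_zero_of_natDegree_lt (by omega)
  have hC0 : C = 0 := by
    refine Polynomial.ext fun i => ?_
    rw [coeff_zero]
    by_cases hi : i ≤ d
    · have h0 := (key (d - i)).2
      rw [combCoeff, if_pos (by omega), show d - (d - i) = i by omega, hE0] at h0
      simpa using h0
    · exact coeff_eq_zero_of_natDegree_lt (by omega)
  exact ⟨hA0, hB0, hC0, hE0⟩

/-- The same for integer polynomials and `aeval` (the form of Viola–Zudilin's Lemma 2.1).
[folklore] -/
theorem eq_zero_of_polylog_log_combination_int {A B C E : ℤ[X]}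
    (h : ∀ z : ℝ, 2 ≤ z → aeval z A + aeval z B * polylogSeries 2 (1 / z) +
      Real.log z * (aeval z C + aeval z E * polylogSeries 1 (1 / z)) = 0) :
    A = 0 ∧ B = 0 ∧ C = 0 ∧ E = 0 := by
  have key := eq_zero_of_polylog_log_combination (A := A.map (Int.castRingHom ℝ)) (B := B.map (Int.castRingHom ℝ))
    (C := C.map (Int.castRingHom ℝ)) (E := E.map (Int.castRingHom ℝ)) fun z hz => by
      simpa only [eval_map, ← algebraMap_int_eq, ← aeval_def] using h z hz
  have hinj := Polynomial.map_injective (Int.castRingHom ℝ) Int.cast_injective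
  refine ⟨hinj ?_, hinj ?_, hinj ?_, hinj ?_⟩ <;>
    simp only [Polynomial.map_zero, key.1, key.2.1, key.2.2.1, key.2.2.2]

/-- **Uniqueness of the `(P, Q, R)`-representation.** If for all `z ≥ 2`
`N(z)·F(z) = P(z) − Q(z) Li₂(1/z) + log z·(R(z) − Q'(z) Li₁(1/z))` holds with two triples … more
precisely: two representations `P₁ − Q₁ Li₂ + log z (R₁ − S₁ Li₁) = P₂ − Q₂ Li₂ + log z (R₂ − S₂ Li₁)` of the
same function on `[2,∞)` have `P₁ = P₂`, `Q₁ = Q₂`, `R₁ = R₂`, `S₁ = S₂`. [folklore] -/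
theorem polylog_log_representation_unique {P₁ Q₁ R₁ S₁ P₂ Q₂ R₂ S₂ : ℤ[X]}
    (h : ∀ z : ℝ, 2 ≤ z →
      aeval z P₁ - aeval z Q₁ * polylogSeries 2 (1 / z) + Real.log z * (aeval z R₁ - aeval z S₁ * polylogSeries 1 (1 / z)) =
      aeval z P₂ - aeval z Q₂ * polylogSeries 2 (1 / z) + Real.log z * (aeval z R₂ - aeval z S₂ * polylogSeries 1 (1 / z))) :
    P₁ = P₂ ∧ Q₁ = Q₂ ∧ R₁ = R₂ ∧ S₁ = S₂ := by
  have key := eq_zero_of_polylog_log_combination_int (A := P₁ - P₂) (B := Q₂ - Q₁) (C := R₁ - R₂) (E := S₂ - S₁)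
    fun z hz => by
      simp only [map_sub]
      linear_combination h z hz
  obtain ⟨h1, h2, h3, h4⟩ := key
  exact ⟨sub_eq_zero.1 h1, (sub_eq_zero.1 h2).symm, sub_eq_zero.1 h3, (sub_eq_zero.1 h4).symm⟩

end DilogPade

end Literature.NumberTheory.DiophantineApproximation

end
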